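import Mathlib
import Summits.ValiantsHypothesis.ValiantsHypothesis.Theorems.BarrierLeverDefinableEquationsProductDepthWallTwoReindex
import Summits.ValiantsHypothesis.ValiantsHypothesis.Theorems.BarrierLeverDefinableEquationsProductDepthWall
import Summits.ValiantsHypothesis.ValiantsHypothesis.Theorems.BarrierLeverDefinableEquationsProductDepthSlice

/-!
# Route BarrierLever — crux `DefinableEquations` (stmt-8745) / item `SingleSizeEquations`
# (stmt-8749): METHOD WALL — the LIMAYE–SRINIVASAN–TAVENAS relative-rank certificates are
# SATURATED INSIDE `SmallCircuits ℂ n 2`, indeed at LINEAR size `6n` (val-np-p5 g15)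

g10's `…ProductDepthWall.lean` placed LST's word polynomial `e_*(P_w)` in `SmallCircuits ℂ n 5`
(a projection of the dense `IMM_{n,d}`, `≤ 4n⁴` gates, under the side condition `2^{|w_{[t]}|} ≤ n`).
This file moves the wall to the crux's FIRST OPEN RUNG `b = 2`:

**Theorem (`exists_fullPdRank_complexity_le_linear`).**  For every word datum `(k, pos)` on
`d ≤ n` blocks and every embedding `e` of the block variables into `x_1, …, x_n` there is
`f ∈ ℂ[x_1..x_n]` of degree `≤ n`, complexity `≤ 6n` and FULL block rank
`pdRank (killCompl e f) = 2^{min(|σ⁺|,|σ⁻|)}` — with NO side condition.  The witness is the word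
polynomial of a REORDERING `pos ∘ π` of the blocks (part 4: merge-ordered prefix + free tail;
part 5: `π` from the sign counts) placed on the same variables: its queue automaton has
`≤ 3 · #variables` transitions (parts 1–3), and block rank does not see the order of the blocks
(part 5, `pdRank_killCompl_reindex`; tree `pdRank_wordPoly`).

**Corollaries (§10).** `exists_fullPdRank_smallCircuits_two` (`n ≥ 6`, every `b ≥ 2`);
`not_forall_pdRank_lt_smallCircuits_two` (the LST class condition fails on `SmallCircuits ℂ n b`,
`b ≥ 2`); `not_relRank_lt_smallCircuits_two` (so does the engine inequality `relRank < 2^{-k/2}`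
for `|w_{[d]}| ≤ k`); `not_isNaturalProof_of_zeroSet_pdRankLt_two` (FSV form, any distinguisher
class, Boolean sums included); `no_pdRankCertificate_smallCircuits_two`;
`not_forall_pdRank_lt_linearSize` (already the class `{deg ≤ n, L ≤ 6n}`).

Chart line (method-wall chart of LANDSCAPE-8749-g10…g14): LST relative rank — WALL `b = 5` (g10)
→ `b = 2`, in fact LINEAR size, like the partial-derivative and single-cut rows; after this file
EVERY classical rank-method row of the chart sits at `b ≤ 2`.  What this is NOT: a wall kills the
rank THRESHOLD `pdRank < 2^min`, not every polynomial in the ideal of its minors; nothing here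
bears on the crux (b = 2 OPEN, Chatterjee–Tengse arXiv:2309.07612 §1.3 dir. 2) or on `VP ≠ VNP`.
No definitions, no named facts, standard axioms.
Refs: Limaye–Srinivasan–Tavenas, J. ACM 72 (2025) Art. 26, §2.2, Lemma 8, Lemma 22;
Forbes–Shpilka–Volk 2018 Def. 1 / Cor. 5.
-/

-- `Summit.ValiantsHypothesis.ValiantsHypothesis.…` repeats a component (D-0017 layout); mandated.
set_option linter.dupNamespace false

noncomputable section

namespace Summit.ValiantsHypothesis.ValiantsHypothesis.Theorems.BarrierLeverDefinableEquations

open MvPolynomial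
open Literature.Computability.AlgebraicComplexity
open Literature.Computability.AlgebraicComplexity.LSTWord
open Literature.Barriers.ValiantsHypothesis
open scoped BigOperators

namespace ProductDepthWallTwo

/-! ## §9 The placed word polynomial at the open rung: `e_*(P_{w ∘ π}) ∈ SmallCircuits ℂ n 2` -/

section Wall

variable {d : ℕ} (k : ℕ) (pos : Fin d → Bool)

/-- **The saturating polynomial at linear size.**  For every word datum `(k, pos)` with `d ≤ n`
and every embedding `e` of its blocks into `x_1, …, x_n` there is `f` of degree `≤ n`,
complexity `≤ 6n`, and FULL block rank `pdRank (killCompl e f) = 2^{min(|σ⁺|,|σ⁻|)}`: the word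
polynomial of a REORDERING of the blocks (merge-ordered prefix + free tail) placed on the same
variables.  No side condition `2^{|w_{[t]}|} ≤ n` is needed.
[cite: LimayeSrinivasanTavenas2025, §2.2 and Lemma 22] -/
theorem exists_fullPdRank_complexity_le_linear {n : ℕ} (hdn : d ≤ n)
    (e : (Σ i : Fin d, BlockVar k pos i) ↪ Fin n) :
    ∃ f : MvPolynomial (Fin n) ℂ, f.totalDegree ≤ n ∧ complexity f ≤ 6 * n ∧
      pdRank ℂ (posBlocks pos) (negBlocks pos) (killCompl e.injective f) =
        2 ^ min (streamLen k pos true d) (streamLen k pos false d) := by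
  classical
  set p := (Finset.univ.filter fun i : Fin d => pos i = true).card with hp
  obtain ⟨w₀, hc, d', hd', hm, hℓ, ht⟩ := (exists_mergeWord k d p (d - p)
    (by have : p ≤ d := (Finset.card_filter_le _ _).trans (by simp); omega)).1
  obtain ⟨π, hπ⟩ := exists_perm_of_card_eq pos w₀ (by rw [hc])
  obtain rfl : (fun t => pos (π t)) = w₀ := funext hπ
  set e' := reixEmb k pos π e
  refine ⟨rename e' (wordPoly k (fun t => pos (π t)) ℂ), ?_, ?_, ?_⟩
  · exact (totalDegree_rename_le _ _).trans
      ((ProductDepthWall.totalDegree_wordPoly_le k _).trans hdn)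
  · refine (complexity_rename_le_holds' (k := ℂ) e' _).trans ?_
    refine (complexity_wordPoly_le_of_mergePrefix k ℂ d' (d - d') d (by omega) _ hm hℓ ht).trans ?_
    refine Nat.mul_le_mul_left _ ?_
    calc ∑ t : Fin d, 2 ^ letterSize k (fun t => pos (π t)) t
        = Fintype.card (Σ t : Fin d, BlockVar k (fun t => pos (π t)) t) := by
          rw [Fintype.card_sigma]
          exact Finset.sum_congr rfl fun t _ => (card_blockVar k _ t).symm
      _ ≤ Fintype.card (Fin n) := Fintype.card_le_of_embedding e'
      _ = n := Fintype.card_fin n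
  · rw [pdRank_killCompl_reindex k pos π e, killCompl_rename_app, pdRank_wordPoly,
      streamLen_reindex, streamLen_reindex]

/-- Hence a member of `SmallCircuits ℂ n 2` of FULL block rank for every `n ≥ 6`, every word
datum with `d ≤ n` and every embedding (g10's `…ProductDepthWall.exists_fullPdRank_smallCircuits`
had exponent `5` and the side condition `2^{|w_{[t]}|} ≤ n`). [cite: ForbesShpilkaVolk2018, Cor. 5] -/
theorem exists_fullPdRank_smallCircuits_two {n : ℕ} (h6 : 6 ≤ n) (hdn : d ≤ n)
    (e : (Σ i : Fin d, BlockVar k pos i) ↪ Fin n) {b : ℕ} (hb : 2 ≤ b) :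
    ∃ f ∈ SmallCircuits ℂ n b,
      pdRank ℂ (posBlocks pos) (negBlocks pos) (killCompl e.injective f) =
        2 ^ min (streamLen k pos true d) (streamLen k pos false d) := by
  obtain ⟨f, hdeg, hL, hrk⟩ := exists_fullPdRank_complexity_le_linear k pos hdn e
  refine ⟨f, ⟨hdeg, hL.trans ?_⟩, hrk⟩
  calc 6 * n ≤ n * n := Nat.mul_le_mul_right _ h6
    _ = n ^ 2 := (sq n).symm
    _ ≤ n ^ b := Nat.pow_le_pow_right (by omega) hb

/-! ## §10 The wall at `b = 2` -/

/-- **The LST class condition fails on `SmallCircuits ℂ n 2`**: for NO word datum (`d ≤ n`) and no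
embedding does `pdRank (killCompl e f) < 2^{min(|σ⁺|,|σ⁻|)}` hold for all `f ∈ SmallCircuits ℂ n b`,
`b ≥ 2`, `n ≥ 6` — the hypothesis `hrank` of `BlockPlacement.not_isSuccinctHittingSet_of_pdRank_lt`
at the crux's first open rung. [cite: LimayeSrinivasanTavenas2025, §2.2] -/
theorem not_forall_pdRank_lt_smallCircuits_two {n : ℕ} (h6 : 6 ≤ n) (hdn : d ≤ n)
    (e : (Σ i : Fin d, BlockVar k pos i) ↪ Fin n) {b : ℕ} (hb : 2 ≤ b) :
    ¬ ∀ f ∈ SmallCircuits ℂ n b,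
      pdRank ℂ (posBlocks pos) (negBlocks pos) (killCompl e.injective f) <
        2 ^ min (streamLen k pos true d) (streamLen k pos false d) := by
  intro h
  obtain ⟨f, hf, hrk⟩ := exists_fullPdRank_smallCircuits_two k pos h6 hdn e hb
  exact absurd (h f hf) (by rw [hrk]; exact lt_irrefl _)

/-- **The engine inequality fails too**: with `|w_{[d]}| ≤ k`, `relRank (killCompl e f) < 2^{-k/2}`
does not hold on `SmallCircuits ℂ n b`, `b ≥ 2`, `n ≥ 6`. [cite: LimayeSrinivasanTavenas2025, §2.2] -/
theorem not_relRank_lt_smallCircuits_two {n : ℕ} (h6 : 6 ≤ n) (hdn : d ≤ n)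
    (hover : overLen k pos d ≤ k) (e : (Σ i : Fin d, BlockVar k pos i) ↪ Fin n) {b : ℕ} (hb : 2 ≤ b) :
    ¬ ∀ f ∈ SmallCircuits ℂ n b,
      relRank ℂ pos Finset.univ (killCompl e.injective f) < (2 : ℝ) ^ (-(k : ℝ) / 2) := by
  classical
  intro h
  obtain ⟨f, hf, hrk⟩ := exists_fullPdRank_smallCircuits_two k pos h6 hdn e hb
  have hge : (2 : ℝ) ^ (-(k : ℝ) / 2) ≤ (2 : ℝ) ^ (-(overLen k pos d : ℝ) / 2) := by
    refine Real.rpow_le_rpow_of_exponent_le (by norm_num) ?_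
    have : (overLen k pos d : ℝ) ≤ k := by exact_mod_cast hover
    linarith
  have hpd := LSTSlice.pdRank_lt_of_relRank_lt k pos (killCompl e.injective f)
    (lt_of_lt_of_le (h f hf) hge)
  rw [hrk] at hpd
  exact lt_irrefl _ hpd

/-- **FSV form.**  A polynomial `D` in the `N = binom(2n,n)` coefficient variables whose zero set on
degree-`≤ n` coefficient vectors is the LST rank-deficient locus (for some word datum with
`d ≤ n` and some embedding) is NOT an `IsNaturalProof` against `SmallCircuits ℂ n b` for any
`b ≥ 2`, `n ≥ 6`, whatever the distinguisher class `𝒟` (any level, Boolean sums included).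
[cite: ForbesShpilkaVolk2018, Def. 1] -/
theorem not_isNaturalProof_of_zeroSet_pdRankLt_two {n : ℕ} (h6 : 6 ≤ n) (hdn : d ≤ n)
    (e : (Σ i : Fin d, BlockVar k pos i) ↪ Fin n) {b : ℕ} (hb : 2 ≤ b)
    (𝒟 : Set (MvPolynomial (degLEMonomials n) ℂ)) (D : MvPolynomial (degLEMonomials n) ℂ)
    (hD : ∀ g : MvPolynomial (Fin n) ℂ, g.totalDegree ≤ n →
      (eval (coeffVector (degLEMonomials n) g) D = 0 ↔
        pdRank ℂ (posBlocks pos) (negBlocks pos) (killCompl e.injective g) <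
          2 ^ min (streamLen k pos true d) (streamLen k pos false d))) :
    ¬ IsNaturalProof (degLEMonomials n) (SmallCircuits ℂ n b) 𝒟 D := by
  rintro ⟨-, -, hvan⟩
  obtain ⟨f, hf, hrk⟩ := exists_fullPdRank_smallCircuits_two k pos h6 hdn e hb
  have := (hD f hf.1).1 (hvan f hf)
  rw [hrk] at this
  exact lt_irrefl _ this

/-- **Certificate form.**  No `D` in the coefficient variables that is NONZERO at every degree-`≤ n`
polynomial of full block rank (soundness of an LST-type certificate for the datum) vanishes on
`SmallCircuits ℂ n b`, `b ≥ 2`, `n ≥ 6`. [cite: ForbesShpilkaVolk2018, Def. 1] -/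
theorem no_pdRankCertificate_smallCircuits_two {n : ℕ} (h6 : 6 ≤ n) (hdn : d ≤ n)
    (e : (Σ i : Fin d, BlockVar k pos i) ↪ Fin n) {b : ℕ} (hb : 2 ≤ b) :
    ¬ ∃ D : MvPolynomial (degLEMonomials n) ℂ,
      (∀ g : MvPolynomial (Fin n) ℂ, g.totalDegree ≤ n →
        pdRank ℂ (posBlocks pos) (negBlocks pos) (killCompl e.injective g) =
          2 ^ min (streamLen k pos true d) (streamLen k pos false d) →
        eval (coeffVector (degLEMonomials n) g) D ≠ 0) ∧
      ∀ f ∈ SmallCircuits ℂ n b, eval (coeffVector (degLEMonomials n) f) D = 0 := by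
  rintro ⟨D, hsound, hvan⟩
  obtain ⟨f, hf, hrk⟩ := exists_fullPdRank_smallCircuits_two k pos h6 hdn e hb
  exact hsound f hf.1 hrk (hvan f hf)

/-- **The class condition already fails at LINEAR size**: in the class of degree-`≤ n` polynomials
of complexity `≤ 6n` (`n ≥ d`) some member has full block rank for the datum — LST's relative-rank
method joins the partial-derivative and single-cut methods on the chart's linear row.
[cite: LimayeSrinivasanTavenas2025, §2.2] -/
theorem not_forall_pdRank_lt_linearSize {n : ℕ} (hdn : d ≤ n)
    (e : (Σ i : Fin d, BlockVar k pos i) ↪ Fin n) :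
    ¬ ∀ f : MvPolynomial (Fin n) ℂ, f.totalDegree ≤ n → complexity f ≤ 6 * n →
      pdRank ℂ (posBlocks pos) (negBlocks pos) (killCompl e.injective f) <
        2 ^ min (streamLen k pos true d) (streamLen k pos false d) := by
  intro h
  obtain ⟨f, hdeg, hL, hrk⟩ := exists_fullPdRank_complexity_le_linear k pos hdn e
  exact absurd (h f hdeg hL) (by rw [hrk]; exact lt_irrefl _)

end Wall

end ProductDepthWallTwo

end Summit.ValiantsHypothesis.ValiantsHypothesis.Theorems.BarrierLeverDefinableEquations
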